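import Summits.NavierStokesRegularity.NavierStokesRegularity.Theses.AxisymmetricExtremality
import Summits.NavierStokesRegularity.NavierStokesRegularity.Theorems.AxisymmetricExtremalityAxisymmetricKatoGlobalNoSwirlStratum
import Literature.Analysis.FluidPDE.AxisymmetricReflection
import HarnessLib

/-!
# Strategist s19-g5 (family `s`, independent census) — typed bookkeeping for the crux
`AxisymmetricKatoGlobal` (stmt-NavierStokesRegularity-15453) of route `AxisymmetricExtremality`

Nothing here is new mathematics; every theorem is a few lines of logic over LANDED tree results.
It certifies the claims of `STRATEGY-CENSUS-s19-g5.md`: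

* §A `NoAxisymMinimalDatum` (W₀: no Rusin–Šverák minimal blow-up datum is axisymmetric) is the
  WEAKEST statement the route's deciding theorem can consume in place of the crux
  (`closes_of_noAxisymMinimalDatum`), and the crux implies it (`noAxisymMinimalDatum_of_crux`).
* §B the O(2) stratum of W₀ is a THEOREM (`no_O2_minimalBlowupDatum`: an axisymmetric minimal
  blow-up datum that is also equivariant under the meridian mirror `reflY` is swirl-free, hence
  global by the landed no-swirl stratum, contradiction); consequently the "dihedral Smith bypass"
  (`MinimalDatumDihedral`, `DihedralToO2`) closes the summit WITHOUT the crux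
  (`summit_of_dihedral`) — and is therefore summit-equivalent, provable only vacuously
  (`minimalDatumDihedral_iff_summit`).
-/

set_option linter.dupNamespace false
set_option autoImplicit false

noncomputable section

namespace Summit.NavierStokesRegularity.NavierStokesRegularity.Cruxes.AxisymmetricKatoGlobal.StrategistS19g5

open MeasureTheory
open Literature.Analysis.FluidPDE Literature.Analysis.FunctionSpaces
open Summit.NavierStokesRegularity.NavierStokesRegularity.Theses.AxisymmetricExtremality
open Summit.NavierStokesRegularity.NavierStokesRegularity.Theorems.AxisymmetricKatoGlobal.NoSwirlStratum

local notation "ℝ³" => EuclideanSpace ℝ (Fin 3)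
local notation "ℂ³" => EuclideanSpace ℂ (Fin 3)

/-! ## §A  The weakest admissible intermediate W₀ -/

/-- Clay (A) fails at viscosity `ν` — verbatim the antecedent of the route crux `MinimalDatumPFold`. -/
def ClayFailsAt (ν : ℝ) : Prop :=
  ∃ v₀ : ℝ³ → ℝ³, ContDiff ℝ (⊤ : ℕ∞) v₀ ∧ NSWave0.IsDivFree v₀ ∧ HasRapidSpatialDecay v₀ ∧
    ¬ ∃ (u : ℝ → ℝ³ → ℝ³) (p : ℝ → ℝ³ → ℝ), IsSmoothOnHalfSpace u ∧ IsSmoothOnHalfSpace p ∧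
      IsNavierStokesSolution ν 0 v₀ u p ∧ HasBoundedEnergy u

/-- `p`-fold rotational equivariance about the `x₂`-axis, written out as in the route file. -/
def PFoldClause (p : ℕ) (u₀ : ℝ³ → ℝ³) : Prop :=
  ∀ x : ℝ³, u₀ (WithLp.toLp 2 ![Real.cos (2 * Real.pi / p) * x 0 - Real.sin (2 * Real.pi / p) * x 1,
      Real.sin (2 * Real.pi / p) * x 0 + Real.cos (2 * Real.pi / p) * x 1, x 2]) =
    WithLp.toLp 2 ![Real.cos (2 * Real.pi / p) * u₀ x 0 - Real.sin (2 * Real.pi / p) * u₀ x 1,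
      Real.sin (2 * Real.pi / p) * u₀ x 0 + Real.cos (2 * Real.pi / p) * u₀ x 1, u₀ x 2]

/-- Equivariance under the meridian mirror `σ (x₀,x₁,x₂) = (x₀,−x₁,x₂)` (`reflY`). Together with
all `R_θ` this is `O(2)`-equivariance; together with `R_{2π/p}` it is `D_p`-equivariance. -/
def MirrorClause (u₀ : ℝ³ → ℝ³) : Prop :=
  ∀ x : ℝ³, u₀ (reflY x) = reflY (u₀ x)

/-- **W₀.** No Rusin–Šverák `Ḣ^{1/2}`-minimal blow-up datum is axisymmetric. -/
def NoAxisymMinimalDatum : Prop :=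
  ∀ ν : ℝ, 0 < ν → ∀ (u₀ : ℝ³ → ℝ³) (g : HomSobolev ℝ³ ℂ³ (1 / 2 : ℝ)),
    IsMinimalBlowupDatum ν u₀ g → IsAxisymmetric u₀ → False

/-- The crux implies W₀ (one line: the minimality clause `¬HasGlobalKatoSolution`). -/
theorem noAxisymMinimalDatum_of_crux (h : AxisymmetricKatoGlobal) : NoAxisymMinimalDatum := by
  intro ν hν u₀ g hmin hax
  obtain ⟨hL3, hrep, hdiv, -, hnot⟩ := hmin
  exact hnot (h ν hν u₀ g hL3 hrep hdiv (fun θ x => hax θ x))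

/-- **W₀ is all that `closes` consumes**: the deciding theorem of the route goes through verbatim
with W₀ in place of `AxisymmetricKatoGlobal` (the crux is applied only at the axisymmetric minimal
blow-up datum produced by `MinimalDatumPFold` + `PFoldToAxisymmetric`). -/
theorem closes_of_noAxisymMinimalDatum (h₂ : MinimalDatumPFold) (h₄ : PFoldToAxisymmetric)
    (hW : NoAxisymMinimalDatum) : NavierStokesRegularity := by
  show Literature.NS.NavierStokesExistenceSmoothR3
  intro ν hν u₀ hsm hdiv hdec
  by_contra hno
  obtain ⟨u₁, g, hmin, hax⟩ := h₄ ν hν (h₂ ν hν ⟨u₀, hsm, hdiv, hdec, hno⟩)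
  exact hW ν hν u₁ g hmin (fun θ x => hax θ x)

/-- The summit does not touch W₀'s hypothesis: under `NavierStokesRegularity` the antecedent of
`MinimalDatumPFold` is empty, so the route can never feed the crux anything but a minimal datum. -/
theorem not_clayFailsAt_of_summit (hS : NavierStokesRegularity) {ν : ℝ} (hν : 0 < ν) :
    ¬ ClayFailsAt ν := by
  rintro ⟨v₀, hsm, hdiv, hdec, hno⟩
  exact hno (hS ν hν v₀ hsm hdiv hdec)

/-! ## §B  The O(2) stratum of W₀ is a theorem; the dihedral bypass is vacuous -/

/-- **No `O(2)`-equivariant minimal blow-up datum.** An axisymmetric minimal blow-up datum which is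
also mirror-equivariant is swirl-free (`IsAxisymmetric.hasNoSwirl_of_reflY_eq`), hence has a global
Kato solution by the landed swirl-free stratum of the crux
(`hasGlobalKatoSolution_of_isAxisymmetric_hasNoSwirl_viscosity`, built on Ladyzhenskaya /
Ukhovskii–Yudovich + Seregin 2022), contradicting minimality. -/
theorem no_O2_minimalBlowupDatum {ν : ℝ} (hν : 0 < ν) {u₀ : ℝ³ → ℝ³}
    {g : HomSobolev ℝ³ ℂ³ (1 / 2 : ℝ)} (hmin : IsMinimalBlowupDatum ν u₀ g)
    (hax : IsAxisymmetric u₀) (hσ : MirrorClause u₀) : False := by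
  obtain ⟨hL3, -, hdiv, -, hnot⟩ := hmin
  exact hnot (hasGlobalKatoSolution_of_isAxisymmetric_hasNoSwirl_viscosity hν hL3 hdiv hax
    (hax.hasNoSwirl_of_reflY_eq hσ))

/-- W₀ restricted to mirror-equivariant data holds outright. -/
theorem noAxisymMinimalDatum_mirror_stratum :
    ∀ ν : ℝ, 0 < ν → ∀ (u₀ : ℝ³ → ℝ³) (g : HomSobolev ℝ³ ℂ³ (1 / 2 : ℝ)),
      IsMinimalBlowupDatum ν u₀ g → IsAxisymmetric u₀ → MirrorClause u₀ → False :=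
  fun _ hν _ _ hmin hax hσ => no_O2_minimalBlowupDatum hν hmin hax hσ

/-- The dihedral strengthening of the route crux `MinimalDatumPFold`: Clay failure at `ν` ⇒ for
unboundedly many `p` a `D_p`-equivariant (p-fold AND mirror) minimal blow-up datum — the would-be
output of Smith theory for the 2-groups `D_{2^k}` on an `F₂`-acyclic moduli space `M̂(ν)`. -/
def MinimalDatumDihedral : Prop :=
  ∀ ν : ℝ, 0 < ν → ClayFailsAt ν → ∀ N : ℕ, ∃ p : ℕ, N ≤ p ∧ 2 ≤ p ∧
    ∃ (u₀ : ℝ³ → ℝ³) (g : HomSobolev ℝ³ ℂ³ (1 / 2 : ℝ)),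
      IsMinimalBlowupDatum ν u₀ g ∧ PFoldClause p u₀ ∧ MirrorClause u₀

/-- The `σ`-twin of the PROVED crux `PFoldToAxisymmetric`: the compactness upgrade from `D_p`
(unboundedly many `p`) to `O(2)` — the recentring translations of the proved upgrade are along the
axis and scalings commute with `σ`, so the mirror clause should survive the same limit. Expected
provable by the same proof (`…Theorems.AxisymmetricExtremalityPFoldToAxisymmetric*`). -/
def DihedralToO2 : Prop :=
  ∀ ν : ℝ, 0 < ν → (∀ N : ℕ, ∃ p : ℕ, N ≤ p ∧ 2 ≤ p ∧
      ∃ (u₀ : ℝ³ → ℝ³) (g : HomSobolev ℝ³ ℂ³ (1 / 2 : ℝ)),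
        IsMinimalBlowupDatum ν u₀ g ∧ PFoldClause p u₀ ∧ MirrorClause u₀) →
    ∃ (u₀ : ℝ³ → ℝ³) (g : HomSobolev ℝ³ ℂ³ (1 / 2 : ℝ)),
      IsMinimalBlowupDatum ν u₀ g ∧ IsAxisymmetric u₀ ∧ MirrorClause u₀

/-- The dihedral statement strengthens the existing crux (drop the mirror). -/
theorem minimalDatumPFold_of_dihedral (hD : MinimalDatumDihedral) : MinimalDatumPFold := by
  intro ν hν hclay N
  obtain ⟨p, hNp, h2p, u₀, g, hmin, hp, -⟩ := hD ν hν hclay N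
  exact ⟨p, hNp, h2p, u₀, g, hmin, hp⟩

/-- **The bypass closes the summit with NO regularity crux**: `MinimalDatumDihedral → DihedralToO2 →
NavierStokesRegularity`, because the `O(2)`-equivariant minimal datum it produces cannot exist
(`no_O2_minimalBlowupDatum`). -/
theorem summit_of_dihedral (hD : MinimalDatumDihedral) (hO : DihedralToO2) :
    NavierStokesRegularity := by
  show Literature.NS.NavierStokesExistenceSmoothR3
  intro ν hν u₀ hsm hdiv hdec
  by_contra hno
  obtain ⟨u₁, g, hmin, hax, hσ⟩ := hO ν hν (hD ν hν ⟨u₀, hsm, hdiv, hdec, hno⟩)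
  exact no_O2_minimalBlowupDatum hν hmin hax hσ

/-- … and conversely the summit gives `MinimalDatumDihedral` by vacuity of its antecedent. -/
theorem minimalDatumDihedral_of_summit (hS : NavierStokesRegularity) : MinimalDatumDihedral := by
  intro ν hν hclay
  exact absurd hclay (not_clayFailsAt_of_summit hS hν)

/-- **Verdict on the bypass.** Modulo the (provable) upgrade `DihedralToO2`, the dihedral fixed-point
statement IS the summit: it can hold only vacuously (when Clay (A) holds there is nothing to fix;
when Clay (A) fails at `ν`, `M̂(ν) ≠ ∅` and a `D_p`-fixed point for unboundedly many `p` would be an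
`O(2)`-equivariant minimal datum, which does not exist). In particular a non-empty `M̂(ν)` is never
`F₂`-acyclic with the dihedral 2-groups acting (Smith, Allday–Puppe Cor. 1.3.7), so the Smith line
must use ODD primes only, whose fixed points are p-fold data WITH swirl: the crux
`AxisymmetricKatoGlobal` (or W₀) is irreducibly needed. -/
theorem minimalDatumDihedral_iff_summit (hO : DihedralToO2) :
    MinimalDatumDihedral ↔ NavierStokesRegularity :=
  ⟨fun hD => summit_of_dihedral hD hO, minimalDatumDihedral_of_summit⟩

/-- Under Clay failure at `ν` (the only regime in which the route does any work) the dihedral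
conclusion is REFUTED outright, given the upgrade. -/
theorem not_dihedral_data_of_clayFailsAt (hO : DihedralToO2) {ν : ℝ} (hν : 0 < ν)
    (_hclay : ClayFailsAt ν) :
    ¬ (∀ N : ℕ, ∃ p : ℕ, N ≤ p ∧ 2 ≤ p ∧
      ∃ (u₀ : ℝ³ → ℝ³) (g : HomSobolev ℝ³ ℂ³ (1 / 2 : ℝ)),
        IsMinimalBlowupDatum ν u₀ g ∧ PFoldClause p u₀ ∧ MirrorClause u₀) := by
  intro h
  obtain ⟨u₁, g, hmin, hax, hσ⟩ := hO ν hν h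
  exact no_O2_minimalBlowupDatum hν hmin hax hσ

end Summit.NavierStokesRegularity.NavierStokesRegularity.Cruxes.AxisymmetricKatoGlobal.StrategistS19g5

end
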